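import Summits.QuantumFields.YangMills.Theorems.UnitScaleTiltProp7TwistedOneStepDefectCovGauge
import Summits.QuantumFields.YangMills.Theorems.UnitScaleTiltProp7DbarLinCovDefect
import Summits.QuantumFields.YangMills.Theorems.UnitScaleTiltProp8ChartKernelCauchy
import HarnessLib

/-!
# Route `UnitScaleTilt`, crux K1 «MinimiserStabilityRegPr» (stmt-QuantumFields-19200), EX display row (157)-twˢ `hC157`, C-ENTRY line, file F-3a —
# **(148) AT A CURVED BACKGROUND: THE DERIVATIVE OF THE ONE-STEP REMAINDER AT A SMALL POINT OF THE READ BALL**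
# ([Balaban1985Averaging] (148) p.40 «|⟨δC(V₀, A)/δA, δA⟩| ≤ C″₁|A|·Q″|δA|», for the symmetric one-step chart `f_V(y)(c) = log[U̿(V; e^{y}V)(c)·Ū(V)(c)⁻¹]` at a background `V`
# that is bond-small only through a `U1`-valued gauge — by gauge covariance, holomorphy on the read ball, and the Cauchy letter ✓`ChartKernelCauchy.ineq148_local`)

Cell `ym3-torus` (HUMAN RULING D-0037: YM₃ on T³ is ladder rung R3, not the Clay problem), width seat `ym3-torus-px18` gen 3; ★w2-19200 g8 «C-ENTRY GO».  `--supports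
stmt-QuantumFields-19200 --as helper`; def-free, 0 sorry; count-neutral.

LETTERS = ★routeR-w6 g7 ✓`Prop7TwistedOneStepDefectCov`∕`…CovGauge` VERBATIM: `u` `U1`-valued, `V^u` within `s₀` of `1` on the read set `Rd(c)` (bonds with both ends in the blocks of
`c`), window `1000ℓ(2s₀ + 3R) ≤ 1`, `0 < R`, sup letter `B := L·3R + 22100ℓ²(s₀ + (s₀ + 3R))²` (✓`norm_chart_le`: `‖f‖ ≤ 2B` on the ball).
§1 (generic complete normed algebra): `differentiableAt_chart_of_gauge` (at EVERY `‖y₀‖ < R`, generalising ✓`differentiableAt_chart_zero_of_gauge`: `f_V = Ad_{u(emb c₋)}⁻¹ ∘ f_{V^u} ∘ Ad_u`,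
✓`analyticAt_chart`), `norm_chart_le_of_gauge` (`‖f_V(y)(c)‖ ≤ 2B`, `U1`-contraction), `differentiableAt_chart_of_reads`∕`norm_chart_le_of_reads` (read-ball forms by locality
✓`chart_congr`), ★★★ `norm_fderiv_chartRem_le_of_gauge` — for `‖y b‖ ≤ s` on `Rd(c)`, `0 ≤ s < R/8`, every `w`:
`‖D(f_V(·)(c) − Df_V(·)(c)(0))(y)[w]‖ ≤ (32·2B/R²)·s·Σ_{b ∈ Rd(c)} ‖w b‖` (✓`ineq148_local`), and `norm_fderiv_chart_sub_fderiv_zero_le_of_gauge` — the same for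
`‖Df_V(y)[w] − Df_V(0)[w]‖` when `‖y‖ ≤ s` globally: THE `hE` LETTER of ✓`ChartKernelTower.kernel_tower_bound_le` (`G·s_m`, `G = 64B/R²`) at a curved background.
§2 (SU(2), the tower `Ū₀ˡ = emlIterU l U₀♭` of a `PlaqSmall a₀ U₀` background, ★routeR-w6's cluster axial gauges, `s₀ := s₀(l) = 30ℓLˡ·2d(3L^{l+1} − 1)a₀`, budgets VERBATIM from
✓`norm_chart_sub_fderiv_le_localMass_of_plaqSmall`): ★★ `norm_fderiv_chart_sub_fderiv_zero_le_of_plaqSmall`, `differentiableAt_chart_of_plaqSmall`.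
HONEST SCOPE.  Instantiation of landed bricks (no new estimate); constants crude; with F-1 (✓`LeakyLinearTower`), F-2 (`…CovKernelOneStep`) this supplies `hE`; orbit sizes (F-3b),
the assembly (F-4) and the T³ reading of `hC157` (F-5) remain; nothing of `hC157`, EX, E′ or the crux is claimed; rung R3, not d = 4; YM gap NOT proved.

References: T. Bałaban, CMP **98** (1985) 17–51 [Balaban1985Averaging] ((11)–(12) p.19, (89) p.31, (121)–(125) p.36, (140) p.39, (148) p.40, (161)–(163) p.42).
-/

noncomputable section

open scoped BigOperators
open NormedSpace Metric Set Finset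

namespace Summit.QuantumFields.YangMills.Theorems.Prop7CovKernel148

open Literature.MathematicalPhysics.QuantumFieldTheory.Balaban1983to89
open T4Continuum BlockAveraging AveragingRT ExpMeanLog MatrixLog
open B15DeterminingSets (embIter)
open B7Prop1Explicit (expUnit val_expUnit U1 mem_U1)
open B10Eq27TorusAxialLog (axialT gaugeActT gaugeActT_apply unitsField toUField suIncl)
open Summit.QuantumFields.YangMills.Theorems.Prop8Chart (emlAvgU emlIterU)
open Summit.QuantumFields.YangMills.Theorems.Prop7SymAvgTwSym (dbarCovU)
open Summit.QuantumFields.YangMills.Theorems.Prop7TwistedOneStepDefectCov (analyticAt_chart norm_chart_le chart_zero chart_congr)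
open Summit.QuantumFields.YangMills.Theorems.Prop7TwistedOneStepDefectCovGauge (pert_conj chart_gaugeActT_conj differentiableAt_conjField norm_conj_le_and_ge
  transfUp_toUnits_mem_U1 norm_bgTower_gauged_sub_one_le_of_plaqSmall)
open Summit.QuantumFields.YangMills.Theorems.Prop7DbarLinCovDefect (norm_adField_le)
open Summit.QuantumFields.YangMills.Theorems.ChartKernelCauchy (ineq148_local)

/-! ## §1 Generic: the chart through a gauge — differentiability and size on the ball, (148) on the read ball -/

section Generic

variable {P : Params} {j : ℕ}
variable {𝔸 : Type*} [NormedRing 𝔸] [NormedAlgebra ℂ 𝔸] [CompleteSpace 𝔸] [NormOneClass 𝔸]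

/-- **DIFFERENTIABILITY ON THE BALL THROUGH A GAUGE**: `u` `U1`-valued, `V^u` within `s₀` of `1` on the read set of `c`, window `1000ℓ(2s₀+3R) ≤ 1`; then `y ↦ f_V(y)(c)` is
ℂ-differentiable at every `‖y₀‖ < R` — `f_V = Ad_{u(emb c₋)}⁻¹ ∘ f_{V^u} ∘ Ad_u`, `‖Ad_u y₀‖ ≤ ‖y₀‖` and ✓`analyticAt_chart` at `Ad_u y₀`. [cite: Balaban1985Averaging, (11)–(12) p.19, p.44] -/
theorem differentiableAt_chart_of_gauge (hj : j + 1 ≤ P.m + P.K) (u : GaugeTransf P j 𝔸ˣ) (hu : ∀ x, u x ∈ U1 𝔸) (V : GaugeField P j 𝔸ˣ) (c : PBond P (j + 1))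
    {s₀ R : ℝ} (hs₀ : 0 ≤ s₀) (hwin : 1000 * (((P.d + 2) * P.L : ℕ) : ℝ) * (2 * s₀ + 3 * R) ≤ 1)
    (hVu : ∀ b : PBond P j, (blockOf b.src = c.src ∨ blockOf b.src = c.tgt) → (blockOf b.tgt = c.src ∨ blockOf b.tgt = c.tgt) →
      ‖((gaugeActT u V b : 𝔸ˣ) : 𝔸) - 1‖ ≤ s₀)
    {y₀ : PBond P j → 𝔸} (hy₀ : ‖y₀‖ < R) :
    DifferentiableAt ℂ (fun y : PBond P j → 𝔸 =>
      mlog (((dbarCovU V (fun b => expUnit (y b) * V b) c : 𝔸ˣ) : 𝔸) * (((emlAvgU V c)⁻¹ : 𝔸ˣ) : 𝔸))) y₀ := by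
  set Gu : (PBond P j → 𝔸) → 𝔸 := fun y =>
    mlog (((dbarCovU (gaugeActT u V) (fun b => expUnit (y b) * gaugeActT u V b) c : 𝔸ˣ) : 𝔸) * (((emlAvgU (gaugeActT u V) c)⁻¹ : 𝔸ˣ) : 𝔸)) with hGudef
  set Ad : (PBond P j → 𝔸) → (PBond P j → 𝔸) := fun y b => ((u b.src : 𝔸ˣ) : 𝔸) * y b * (((u b.src)⁻¹ : 𝔸ˣ) : 𝔸) with hAd
  set w : 𝔸ˣ := u (emb c.src) with hw
  have hcov' : ∀ y' : PBond P j → 𝔸, mlog (((dbarCovU V (fun b => expUnit (y' b) * V b) c : 𝔸ˣ) : 𝔸) * (((emlAvgU V c)⁻¹ : 𝔸ˣ) : 𝔸)) =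
      ((w⁻¹ : 𝔸ˣ) : 𝔸) * Gu (Ad y') * (w : 𝔸) := by
    intro y'
    have h : Gu (Ad y') = (w : 𝔸) * mlog (((dbarCovU V (fun b => expUnit (y' b) * V b) c : 𝔸ˣ) : 𝔸) * (((emlAvgU V c)⁻¹ : 𝔸ˣ) : 𝔸)) * ((w⁻¹ : 𝔸ˣ) : 𝔸) :=
      chart_gaugeActT_conj u V y' c
    rw [h]; simp only [← mul_assoc, Units.inv_mul, one_mul]; rw [mul_assoc, Units.inv_mul, mul_one]
  have hAdn : ‖Ad y₀‖ < R := (norm_adField_le u (fun x => (mem_U1.1 (hu x)).1) (fun x => (mem_U1.1 (hu x)).2) y₀).trans_lt hy₀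
  have hGu_an : DifferentiableAt ℂ Gu (Ad y₀) := (analyticAt_chart hj (gaugeActT u V) c hs₀ hwin hVu hAdn).differentiableAt
  have hGuAd : DifferentiableAt ℂ (fun y' => Gu (Ad y')) y₀ := hGu_an.comp y₀ (differentiableAt_conjField u y₀)
  rw [show (fun y : PBond P j → 𝔸 => mlog (((dbarCovU V (fun b => expUnit (y b) * V b) c : 𝔸ˣ) : 𝔸) * (((emlAvgU V c)⁻¹ : 𝔸ˣ) : 𝔸))) =
    fun y' => ((w⁻¹ : 𝔸ˣ) : 𝔸) * Gu (Ad y') * (w : 𝔸) from funext hcov']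
  exact ((differentiableAt_const _).mul hGuAd).mul (differentiableAt_const _)

omit [CompleteSpace 𝔸] in
/-- **THE SIZE OF THE CHART ON THE BALL THROUGH A GAUGE**: `‖f_V(y)(c)‖ ≤ 2B` for `‖y‖ < R`, `B := L·3R + 22100ℓ²(s₀ + (s₀ + 3R))²` (`U1`-contraction of the conjugation and
✓`norm_chart_le` at `Ad_u y`). [cite: Balaban1985Averaging, (121)–(125) p.36, (11)–(12) p.19] -/
theorem norm_chart_le_of_gauge [CompleteSpace 𝔸] (hj : j + 1 ≤ P.m + P.K) (u : GaugeTransf P j 𝔸ˣ) (hu : ∀ x, u x ∈ U1 𝔸) (V : GaugeField P j 𝔸ˣ) (c : PBond P (j + 1))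
    {s₀ R : ℝ} (hs₀ : 0 ≤ s₀) (hwin : 1000 * (((P.d + 2) * P.L : ℕ) : ℝ) * (2 * s₀ + 3 * R) ≤ 1)
    (hVu : ∀ b : PBond P j, (blockOf b.src = c.src ∨ blockOf b.src = c.tgt) → (blockOf b.tgt = c.src ∨ blockOf b.tgt = c.tgt) →
      ‖((gaugeActT u V b : 𝔸ˣ) : 𝔸) - 1‖ ≤ s₀)
    {y : PBond P j → 𝔸} (hy : ‖y‖ < R) :
    ‖mlog (((dbarCovU V (fun b => expUnit (y b) * V b) c : 𝔸ˣ) : 𝔸) * (((emlAvgU V c)⁻¹ : 𝔸ˣ) : 𝔸))‖ ≤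
      2 * ((P.L : ℝ) * (3 * R) + 22100 * (((P.d + 2) * P.L : ℕ) : ℝ) ^ 2 * (s₀ + (s₀ + 3 * R)) ^ 2) := by
  set Ad : (PBond P j → 𝔸) → (PBond P j → 𝔸) := fun y b => ((u b.src : 𝔸ˣ) : 𝔸) * y b * (((u b.src)⁻¹ : 𝔸ˣ) : 𝔸) with hAd
  set w : 𝔸ˣ := u (emb c.src) with hw
  have h : mlog (((dbarCovU (gaugeActT u V) (fun b => expUnit (Ad y b) * gaugeActT u V b) c : 𝔸ˣ) : 𝔸) * (((emlAvgU (gaugeActT u V) c)⁻¹ : 𝔸ˣ) : 𝔸)) =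
      (w : 𝔸) * mlog (((dbarCovU V (fun b => expUnit (y b) * V b) c : 𝔸ˣ) : 𝔸) * (((emlAvgU V c)⁻¹ : 𝔸ˣ) : 𝔸)) * ((w⁻¹ : 𝔸ˣ) : 𝔸) :=
    chart_gaugeActT_conj u V y c
  have hAdn : ‖Ad y‖ < R := (norm_adField_le u (fun x => (mem_U1.1 (hu x)).1) (fun x => (mem_U1.1 (hu x)).2) y).trans_lt hy
  have hg := norm_chart_le hj (gaugeActT u V) c hs₀ hwin hVu hAdn
  rw [h] at hg
  exact ((norm_conj_le_and_ge (hu (emb c.src)) _).2).trans hg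

/-- **READ-BALL DIFFERENTIABILITY**: the chart reads `y` only on `Rd(c)` (✓`chart_congr`), so it is differentiable at every `y₀` whose READ coordinates are `< R` (`0 < R`): it equals its
composition with the truncation to `Rd(c)`, a continuous linear map of norm-`< R` image there. [cite: Balaban1985Averaging, (87)–(92) p.31, p.44] -/
theorem differentiableAt_chart_of_reads (hj : j + 1 ≤ P.m + P.K) (u : GaugeTransf P j 𝔸ˣ) (hu : ∀ x, u x ∈ U1 𝔸) (V : GaugeField P j 𝔸ˣ) (c : PBond P (j + 1))
    {s₀ R : ℝ} (hs₀ : 0 ≤ s₀) (hR : 0 < R) (hwin : 1000 * (((P.d + 2) * P.L : ℕ) : ℝ) * (2 * s₀ + 3 * R) ≤ 1)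
    (hVu : ∀ b : PBond P j, (blockOf b.src = c.src ∨ blockOf b.src = c.tgt) → (blockOf b.tgt = c.src ∨ blockOf b.tgt = c.tgt) →
      ‖((gaugeActT u V b : 𝔸ˣ) : 𝔸) - 1‖ ≤ s₀)
    {y₀ : PBond P j → 𝔸}
    (hy₀ : ∀ b : PBond P j, (blockOf b.src = c.src ∨ blockOf b.src = c.tgt) → (blockOf b.tgt = c.src ∨ blockOf b.tgt = c.tgt) → ‖y₀ b‖ < R) :
    DifferentiableAt ℂ (fun y : PBond P j → 𝔸 =>
      mlog (((dbarCovU V (fun b => expUnit (y b) * V b) c : 𝔸ˣ) : 𝔸) * (((emlAvgU V c)⁻¹ : 𝔸ˣ) : 𝔸))) y₀ := by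
  classical
  set G : (PBond P j → 𝔸) → 𝔸 := fun y => mlog (((dbarCovU V (fun b => expUnit (y b) * V b) c : 𝔸ˣ) : 𝔸) * (((emlAvgU V c)⁻¹ : 𝔸ˣ) : 𝔸)) with hG
  set TB : PBond P j → Prop := fun b => (blockOf b.src = c.src ∨ blockOf b.src = c.tgt) ∧ (blockOf b.tgt = c.src ∨ blockOf b.tgt = c.tgt) with hTB
  set π : (PBond P j → 𝔸) →L[ℂ] (PBond P j → 𝔸) :=
    ContinuousLinearMap.pi fun b : PBond P j => if TB b then ContinuousLinearMap.proj (R := ℂ) (φ := fun _ : PBond P j => 𝔸) b else 0 with hπ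
  have hπ_apply : ∀ (A : PBond P j → 𝔸) (b : PBond P j), π A b = if TB b then A b else 0 := by
    intro A b
    simp only [hπ, ContinuousLinearMap.pi_apply]
    split_ifs <;> rfl
  have hGπ : (G ∘ ⇑π) = G := by
    funext A
    show G (π A) = G A
    exact chart_congr hj V c fun b h1 h2 => by rw [hπ_apply, if_pos (show TB b from ⟨h1, h2⟩)]
  have hπn : ‖π y₀‖ < R := by
    refine (pi_norm_lt_iff hR).2 fun b => ?_
    rw [hπ_apply]
    split_ifs with hb
    · exact hy₀ b hb.1 hb.2
    · rw [norm_zero]; exact hR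
  have hd : DifferentiableAt ℂ G (π y₀) := differentiableAt_chart_of_gauge hj u hu V c hs₀ hwin hVu hπn
  have hcomp : DifferentiableAt ℂ (G ∘ ⇑π) y₀ := hd.comp y₀ π.differentiableAt
  rwa [hGπ] at hcomp

/-- **READ-BALL SIZE**: `‖f_V(y)(c)‖ ≤ 2B` whenever the READ coordinates of `y` are `< R` (locality + `norm_chart_le_of_gauge` at the truncation). [cite: Balaban1985Averaging, (121)–(125) p.36] -/
theorem norm_chart_le_of_reads (hj : j + 1 ≤ P.m + P.K) (u : GaugeTransf P j 𝔸ˣ) (hu : ∀ x, u x ∈ U1 𝔸) (V : GaugeField P j 𝔸ˣ) (c : PBond P (j + 1))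
    {s₀ R : ℝ} (hs₀ : 0 ≤ s₀) (hR : 0 < R) (hwin : 1000 * (((P.d + 2) * P.L : ℕ) : ℝ) * (2 * s₀ + 3 * R) ≤ 1)
    (hVu : ∀ b : PBond P j, (blockOf b.src = c.src ∨ blockOf b.src = c.tgt) → (blockOf b.tgt = c.src ∨ blockOf b.tgt = c.tgt) →
      ‖((gaugeActT u V b : 𝔸ˣ) : 𝔸) - 1‖ ≤ s₀)
    {y : PBond P j → 𝔸}
    (hy : ∀ b : PBond P j, (blockOf b.src = c.src ∨ blockOf b.src = c.tgt) → (blockOf b.tgt = c.src ∨ blockOf b.tgt = c.tgt) → ‖y b‖ < R) :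
    ‖mlog (((dbarCovU V (fun b => expUnit (y b) * V b) c : 𝔸ˣ) : 𝔸) * (((emlAvgU V c)⁻¹ : 𝔸ˣ) : 𝔸))‖ ≤
      2 * ((P.L : ℝ) * (3 * R) + 22100 * (((P.d + 2) * P.L : ℕ) : ℝ) ^ 2 * (s₀ + (s₀ + 3 * R)) ^ 2) := by
  classical
  set yt : PBond P j → 𝔸 := fun b =>
    if (blockOf b.src = c.src ∨ blockOf b.src = c.tgt) ∧ (blockOf b.tgt = c.src ∨ blockOf b.tgt = c.tgt) then y b else 0 with hyt
  have hloc := chart_congr hj V c (y := y) (y' := yt) fun b h1 h2 => by rw [hyt]; dsimp only; rw [if_pos ⟨h1, h2⟩]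
  have hytn : ‖yt‖ < R := by
    refine (pi_norm_lt_iff hR).2 fun b => ?_
    rw [hyt]; dsimp only
    split_ifs with hb
    · exact hy b hb.1 hb.2
    · rw [norm_zero]; exact hR
  rw [hloc]
  exact norm_chart_le_of_gauge hj u hu V c hs₀ hwin hVu hytn

/-- ★★★ **(148) AT A CURVED BACKGROUND** — `u` `U1`-valued, `V^u` within `s₀` of `1` on `Rd(c)`, `0 < R`, window `1000ℓ(2s₀+3R) ≤ 1`, `B := L·3R + 22100ℓ²(s₀+(s₀+3R))²`; then at every
`y` with `‖y b‖ ≤ s` on `Rd(c)`, `0 ≤ s < R/8`, for every direction `w`: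
`‖D(f_V(·)(c) − Df_V(·)(c)(0))(y)[w]‖ ≤ (32·(2B)/R²)·s·Σ_{b ∈ Rd(c)} ‖w b‖` (✓`ineq148_local`: locality ✓`chart_congr`, read-ball holomorphy and size above, `f_V(0)(c) = 0`
✓`chart_zero`). [cite: Balaban1985Averaging, (148) p.40, (140) p.39] -/
theorem norm_fderiv_chartRem_le_of_gauge (hj : j + 1 ≤ P.m + P.K) (u : GaugeTransf P j 𝔸ˣ) (hu : ∀ x, u x ∈ U1 𝔸) (V : GaugeField P j 𝔸ˣ) (c : PBond P (j + 1))
    {s₀ R : ℝ} (hs₀ : 0 ≤ s₀) (hR : 0 < R) (hwin : 1000 * (((P.d + 2) * P.L : ℕ) : ℝ) * (2 * s₀ + 3 * R) ≤ 1)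
    (hVu : ∀ b : PBond P j, (blockOf b.src = c.src ∨ blockOf b.src = c.tgt) → (blockOf b.tgt = c.src ∨ blockOf b.tgt = c.tgt) →
      ‖((gaugeActT u V b : 𝔸ˣ) : 𝔸) - 1‖ ≤ s₀)
    {y : PBond P j → 𝔸} {s : ℝ} (hs0 : 0 ≤ s) (hs : s < R / 8)
    (hy : ∀ b : PBond P j, (blockOf b.src = c.src ∨ blockOf b.src = c.tgt) → (blockOf b.tgt = c.src ∨ blockOf b.tgt = c.tgt) → ‖y b‖ ≤ s)
    (w : PBond P j → 𝔸) :
    ‖fderiv ℂ (fun Z : PBond P j → 𝔸 =>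
          mlog (((dbarCovU V (fun b => expUnit (Z b) * V b) c : 𝔸ˣ) : 𝔸) * (((emlAvgU V c)⁻¹ : 𝔸ˣ) : 𝔸)) -
            fderiv ℂ (fun y : PBond P j → 𝔸 =>
              mlog (((dbarCovU V (fun b => expUnit (y b) * V b) c : 𝔸ˣ) : 𝔸) * (((emlAvgU V c)⁻¹ : 𝔸ˣ) : 𝔸))) 0 Z) y w‖ ≤
      32 * (2 * ((P.L : ℝ) * (3 * R) + 22100 * (((P.d + 2) * P.L : ℕ) : ℝ) ^ 2 * (s₀ + (s₀ + 3 * R)) ^ 2)) / R ^ 2 * s *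
        ∑ b ∈ (univ.filter fun b : PBond P j =>
          (blockOf b.src = c.src ∨ blockOf b.src = c.tgt) ∧ (blockOf b.tgt = c.src ∨ blockOf b.tgt = c.tgt)), ‖w b‖ := by
  classical
  set G : (PBond P j → 𝔸) → 𝔸 := fun y => mlog (((dbarCovU V (fun b => expUnit (y b) * V b) c : 𝔸ˣ) : 𝔸) * (((emlAvgU V c)⁻¹ : 𝔸ˣ) : 𝔸)) with hG
  set Rd : Finset (PBond P j) := univ.filter fun b : PBond P j =>
    (blockOf b.src = c.src ∨ blockOf b.src = c.tgt) ∧ (blockOf b.tgt = c.src ∨ blockOf b.tgt = c.tgt) with hRd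
  have hmem : ∀ b : PBond P j, b ∈ Rd ↔ (blockOf b.src = c.src ∨ blockOf b.src = c.tgt) ∧ (blockOf b.tgt = c.src ∨ blockOf b.tgt = c.tgt) := fun b => by
    rw [hRd, Finset.mem_filter]; exact ⟨fun h => h.2, fun h => ⟨Finset.mem_univ _, h⟩⟩
  have hB0 : 0 ≤ 2 * ((P.L : ℝ) * (3 * R) + 22100 * (((P.d + 2) * P.L : ℕ) : ℝ) ^ 2 * (s₀ + (s₀ + 3 * R)) ^ 2) := by positivity
  have hdep : ∀ W W' : PBond P j → 𝔸, (∀ i ∈ Rd, W i = W' i) → G W = G W' := fun W W' h =>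
    chart_congr hj V c fun b h1 h2 => h b ((hmem b).2 ⟨h1, h2⟩)
  have hdiff : ∀ W : PBond P j → 𝔸, (∀ i ∈ Rd, ‖W i‖ < R) → DifferentiableAt ℂ G W := fun W hW =>
    differentiableAt_chart_of_reads hj u hu V c hs₀ hR hwin hVu fun b h1 h2 => hW b ((hmem b).2 ⟨h1, h2⟩)
  have hBd : ∀ W : PBond P j → 𝔸, (∀ i ∈ Rd, ‖W i‖ < R) →
      ‖G W‖ ≤ 2 * ((P.L : ℝ) * (3 * R) + 22100 * (((P.d + 2) * P.L : ℕ) : ℝ) ^ 2 * (s₀ + (s₀ + 3 * R)) ^ 2) := fun W hW =>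
    norm_chart_le_of_reads hj u hu V c hs₀ hR hwin hVu fun b h1 h2 => hW b ((hmem b).2 ⟨h1, h2⟩)
  have h0 : G 0 = 0 := chart_zero V c
  exact ineq148_local Rd G hdep hR hB0 hdiff hBd h0 hs0 hs (fun b hb => hy b ((hmem b).1 hb).1 ((hmem b).1 hb).2) w

/-- ★★ **THE `hE` LETTER OF ✓`ChartKernelTower.kernel_tower_bound_le` AT A CURVED BACKGROUND**: under the same gauge∕window, for `‖y‖ ≤ s` (globally), `0 ≤ s < R/8`, every `w`:
`‖Df_V(·)(c)(y)[w] − Df_V(·)(c)(0)[w]‖ ≤ (64B/R²)·s·Σ_{b ∈ Rd(c)} ‖w b‖` (the remainder's derivative is the difference of derivatives: the chart is differentiable at `y`,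
`‖y‖ < R`). [cite: Balaban1985Averaging, (148) p.40] -/
theorem norm_fderiv_chart_sub_fderiv_zero_le_of_gauge (hj : j + 1 ≤ P.m + P.K) (u : GaugeTransf P j 𝔸ˣ) (hu : ∀ x, u x ∈ U1 𝔸) (V : GaugeField P j 𝔸ˣ)
    (c : PBond P (j + 1)) {s₀ R : ℝ} (hs₀ : 0 ≤ s₀) (hR : 0 < R) (hwin : 1000 * (((P.d + 2) * P.L : ℕ) : ℝ) * (2 * s₀ + 3 * R) ≤ 1)
    (hVu : ∀ b : PBond P j, (blockOf b.src = c.src ∨ blockOf b.src = c.tgt) → (blockOf b.tgt = c.src ∨ blockOf b.tgt = c.tgt) →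
      ‖((gaugeActT u V b : 𝔸ˣ) : 𝔸) - 1‖ ≤ s₀)
    {y : PBond P j → 𝔸} {s : ℝ} (hs0 : 0 ≤ s) (hs : s < R / 8) (hy : ‖y‖ ≤ s) (w : PBond P j → 𝔸) :
    ‖fderiv ℂ (fun Z : PBond P j → 𝔸 =>
          mlog (((dbarCovU V (fun b => expUnit (Z b) * V b) c : 𝔸ˣ) : 𝔸) * (((emlAvgU V c)⁻¹ : 𝔸ˣ) : 𝔸))) y w -
        fderiv ℂ (fun Z : PBond P j → 𝔸 =>
          mlog (((dbarCovU V (fun b => expUnit (Z b) * V b) c : 𝔸ˣ) : 𝔸) * (((emlAvgU V c)⁻¹ : 𝔸ˣ) : 𝔸))) 0 w‖ ≤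
      64 * ((P.L : ℝ) * (3 * R) + 22100 * (((P.d + 2) * P.L : ℕ) : ℝ) ^ 2 * (s₀ + (s₀ + 3 * R)) ^ 2) / R ^ 2 * s *
        ∑ b ∈ (univ.filter fun b : PBond P j =>
          (blockOf b.src = c.src ∨ blockOf b.src = c.tgt) ∧ (blockOf b.tgt = c.src ∨ blockOf b.tgt = c.tgt)), ‖w b‖ := by
  set G : (PBond P j → 𝔸) → 𝔸 := fun y => mlog (((dbarCovU V (fun b => expUnit (y b) * V b) c : 𝔸ˣ) : 𝔸) * (((emlAvgU V c)⁻¹ : 𝔸ˣ) : 𝔸)) with hG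
  have hyR : ‖y‖ < R := hy.trans_lt (by linarith)
  have hdy : DifferentiableAt ℂ G y := differentiableAt_chart_of_gauge hj u hu V c hs₀ hwin hVu hyR
  have hrem : fderiv ℂ (fun Z => G Z - fderiv ℂ G 0 Z) y w = fderiv ℂ G y w - fderiv ℂ G 0 w := by
    have hh : HasFDerivAt (fun Z : PBond P j → 𝔸 => G Z - fderiv ℂ G 0 Z) (fderiv ℂ G y - fderiv ℂ G 0) y :=
      hdy.hasFDerivAt.sub (fderiv ℂ G 0).hasFDerivAt
    rw [hh.fderiv]
    rfl
  have h := norm_fderiv_chartRem_le_of_gauge hj u hu V c hs₀ hR hwin hVu hs0 hs (fun b _ _ => (norm_le_pi_norm y b).trans hy) w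
  rw [hrem] at h
  refine h.trans (le_of_eq ?_)
  ring

end Generic

/-! ## §2 The SU(2) background tower of a plaquette-small field, in the cluster axial gauges -/

section SU2

open scoped Matrix.Norms.L2Operator

variable {P : Params}

/-- **DIFFERENTIABILITY OF THE LEVEL-`l` CHART OF THE TOWER ON THE BALL `‖y₀‖ < R`** (`V := Ū₀ˡ`, `PlaqSmall a₀ U₀`, budgets `6400ℓ²Lˡs_B ≤ 1`, `1000ℓ(2s₀(l)+3R) ≤ 1`; ★routeR-w6's
cluster axial gauge at `c₋`). [cite: Balaban1985Averaging, (11)–(12) p.19, (161)–(163) p.42, p.44] -/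
theorem differentiableAt_chart_of_plaqSmall {l : ℕ} (hl : l + 2 ≤ P.m + P.K) (U₀ : GaugeField P 0 (Matrix.specialUnitaryGroup (Fin 2) ℂ))
    {a₀ : ℝ} (ha₀ : 0 < a₀) (hU : PlaqSmall a₀ U₀) {R : ℝ}
    (hbud₀ : 6400 * (((P.d + 2) * P.L : ℕ) : ℝ) ^ 2 * (P.L : ℝ) ^ l * (2 * ((P.d : ℝ) * (3 * (P.L : ℝ) ^ (l + 1) - 1)) * a₀) ≤ 1)
    (hwin : 1000 * (((P.d + 2) * P.L : ℕ) : ℝ) * (2 * (30 * (((P.d + 2) * P.L : ℕ) : ℝ) * (P.L : ℝ) ^ l * (2 * ((P.d : ℝ) * (3 * (P.L : ℝ) ^ (l + 1) - 1)) * a₀)) + 3 * R) ≤ 1)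
    (c : PBond P (l + 1)) {y₀ : PBond P l → Matrix (Fin 2) (Fin 2) ℂ} (hy₀ : ‖y₀‖ < R) :
    DifferentiableAt ℂ (fun Z : PBond P l → Matrix (Fin 2) (Fin 2) ℂ =>
          mlog (((dbarCovU (emlIterU l (unitsField (toUField U₀))) (fun b => expUnit (Z b) * emlIterU l (unitsField (toUField U₀)) b) c :
              (Matrix (Fin 2) (Fin 2) ℂ)ˣ) : Matrix (Fin 2) (Fin 2) ℂ) *
            (((emlAvgU (emlIterU l (unitsField (toUField U₀))) c)⁻¹ : (Matrix (Fin 2) (Fin 2) ℂ)ˣ) : Matrix (Fin 2) (Fin 2) ℂ))) y₀ := by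
  have hL1 : (1 : ℝ) ≤ P.L := by exact_mod_cast P.L_pos
  have hs₀0 : 0 ≤ (30 * (((P.d + 2) * P.L : ℕ) : ℝ) * (P.L : ℝ) ^ l * (2 * ((P.d : ℝ) * (3 * (P.L : ℝ) ^ (l + 1) - 1)) * a₀)) := by
    have h3 : (0 : ℝ) ≤ 3 * (P.L : ℝ) ^ (l + 1) - 1 := by linarith [one_le_pow₀ (n := l + 1) hL1]
    have ha := ha₀.le
    positivity
  exact differentiableAt_chart_of_gauge (by omega) _ (transfUp_toUnits_mem_U1 (axialT U₀ (embIter (l + 1) c.src)) l) _ c hs₀0 hwin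
    (norm_bgTower_gauged_sub_one_le_of_plaqSmall hl U₀ ha₀ hU hbud₀ c) hy₀

/-- ★★ **THE `hE` LETTER AT LEVEL `l` OF THE TOWER OF A PLAQUETTE-SMALL SU(2) BACKGROUND** (`V := Ū₀ˡ`, cluster axial gauge at `c₋`, `s₀(l) = 30ℓLˡ·2d(3L^{l+1} − 1)a₀`,
budgets `6400ℓ²Lˡs_B ≤ 1`, `1000ℓ(2s₀(l)+3R) ≤ 1`, `0 < R`): for `‖y‖ ≤ s`, `0 ≤ s < R/8`, every `w`,
`‖Df_l(·)(c)(y)[w] − Df_l(·)(c)(0)[w]‖ ≤ (64B_l/R²)·s·Σ_{b ∈ Rd(c)} ‖w b‖`, `B_l := L·3R + 22100ℓ²(s₀(l) + (s₀(l) + 3R))²`. [cite: Balaban1985Averaging, (148) p.40, (161)–(163) p.42] -/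
theorem norm_fderiv_chart_sub_fderiv_zero_le_of_plaqSmall {l : ℕ} (hl : l + 2 ≤ P.m + P.K) (U₀ : GaugeField P 0 (Matrix.specialUnitaryGroup (Fin 2) ℂ))
    {a₀ : ℝ} (ha₀ : 0 < a₀) (hU : PlaqSmall a₀ U₀) {R s : ℝ} (hR : 0 < R) (hs0 : 0 ≤ s) (hs : s < R / 8)
    (hbud₀ : 6400 * (((P.d + 2) * P.L : ℕ) : ℝ) ^ 2 * (P.L : ℝ) ^ l * (2 * ((P.d : ℝ) * (3 * (P.L : ℝ) ^ (l + 1) - 1)) * a₀) ≤ 1)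
    (hwin : 1000 * (((P.d + 2) * P.L : ℕ) : ℝ) * (2 * (30 * (((P.d + 2) * P.L : ℕ) : ℝ) * (P.L : ℝ) ^ l * (2 * ((P.d : ℝ) * (3 * (P.L : ℝ) ^ (l + 1) - 1)) * a₀)) + 3 * R) ≤ 1)
    (c : PBond P (l + 1)) {y : PBond P l → Matrix (Fin 2) (Fin 2) ℂ} (hy : ‖y‖ ≤ s) (w : PBond P l → Matrix (Fin 2) (Fin 2) ℂ) :
    ‖fderiv ℂ (fun Z : PBond P l → Matrix (Fin 2) (Fin 2) ℂ =>
          mlog (((dbarCovU (emlIterU l (unitsField (toUField U₀))) (fun b => expUnit (Z b) * emlIterU l (unitsField (toUField U₀)) b) c :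
              (Matrix (Fin 2) (Fin 2) ℂ)ˣ) : Matrix (Fin 2) (Fin 2) ℂ) *
            (((emlAvgU (emlIterU l (unitsField (toUField U₀))) c)⁻¹ : (Matrix (Fin 2) (Fin 2) ℂ)ˣ) : Matrix (Fin 2) (Fin 2) ℂ))) y w -
        fderiv ℂ (fun Z : PBond P l → Matrix (Fin 2) (Fin 2) ℂ =>
          mlog (((dbarCovU (emlIterU l (unitsField (toUField U₀))) (fun b => expUnit (Z b) * emlIterU l (unitsField (toUField U₀)) b) c :
              (Matrix (Fin 2) (Fin 2) ℂ)ˣ) : Matrix (Fin 2) (Fin 2) ℂ) *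
            (((emlAvgU (emlIterU l (unitsField (toUField U₀))) c)⁻¹ : (Matrix (Fin 2) (Fin 2) ℂ)ˣ) : Matrix (Fin 2) (Fin 2) ℂ))) 0 w‖ ≤
      64 * ((P.L : ℝ) * (3 * R) + 22100 * (((P.d + 2) * P.L : ℕ) : ℝ) ^ 2 * ((30 * (((P.d + 2) * P.L : ℕ) : ℝ) * (P.L : ℝ) ^ l * (2 * ((P.d : ℝ) * (3 * (P.L : ℝ) ^ (l + 1) - 1)) * a₀)) + ((30 * (((P.d + 2) * P.L : ℕ) : ℝ) * (P.L : ℝ) ^ l * (2 * ((P.d : ℝ) * (3 * (P.L : ℝ) ^ (l + 1) - 1)) * a₀)) + 3 * R)) ^ 2) / R ^ 2 * s *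
        ∑ b ∈ (univ.filter fun b : PBond P l =>
          (blockOf b.src = c.src ∨ blockOf b.src = c.tgt) ∧ (blockOf b.tgt = c.src ∨ blockOf b.tgt = c.tgt)), ‖w b‖ := by
  have hL1 : (1 : ℝ) ≤ P.L := by exact_mod_cast P.L_pos
  have hs₀0 : 0 ≤ (30 * (((P.d + 2) * P.L : ℕ) : ℝ) * (P.L : ℝ) ^ l * (2 * ((P.d : ℝ) * (3 * (P.L : ℝ) ^ (l + 1) - 1)) * a₀)) := by
    have h3 : (0 : ℝ) ≤ 3 * (P.L : ℝ) ^ (l + 1) - 1 := by linarith [one_le_pow₀ (n := l + 1) hL1]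
    have ha := ha₀.le
    positivity
  exact norm_fderiv_chart_sub_fderiv_zero_le_of_gauge (by omega) _ (transfUp_toUnits_mem_U1 (axialT U₀ (embIter (l + 1) c.src)) l) _ c hs₀0 hR hwin
    (norm_bgTower_gauged_sub_one_le_of_plaqSmall hl U₀ ha₀ hU hbud₀ c) hs0 hs hy w

end SU2

end Summit.QuantumFields.YangMills.Theorems.Prop7CovKernel148

end
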